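import Literature.Topology.FourManifolds.SmallTrisectionsChiZero
import Literature.Topology.FourManifolds.CircleProdSumEuler
import Literature.Topology.FourManifolds.LoopSurgeryTrisectionEulerProofs
import Literature.Topology.FourManifolds.LargeKTrisectionClassificationUniv
import HarnessLib

/-!
# Proofs for `SmallTrisectionsChiZero.lean`: the `χ = 0` corollary of Meier–Schirmer–Zupan's
# Thm. 1.2, reduced to the classification theorem itself

Sibling proof file of `Literature/Topology/FourManifolds/SmallTrisectionsChiZero.lean` (D-0014:
a named fact `def X : Prop` is discharged as `theorem X_holds : X`; fact item
`provefact-Literature.Topology.FourManifolds.msz_chiZero_circleProdSphereThree_gk`).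

The named fact `Literature.Topology.FourManifolds.msz_chiZero_circleProdSphereThree_gk` — *a
closed connected oriented smooth `4`-manifold `X` with a `(g; k₀, k₁, k₂)`-trisection in the
sense of `IsGKTrisection`, some `kᵢ + 1 ≥ g`, and `k₀ + k₁ + k₂ = g + 2` (i.e. `χ(X) = 0`) is
diffeomorphic to `S¹ × S³`* — is a COROLLARY of Meier–Schirmer–Zupan 2016, Thm. 1.2
(arXiv:1507.06561, p. 2 and §5: "Suppose that `X` admits a `(g; k₁, k₂, k₃)`–trisection `𝒯`
with `k₁ ≥ g − 1`, and let `k′ = max{k₂, k₃}`" — `min` in the proof, Remark 5.2 and the zbMATH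
review Zbl 1381.57018 — ". Then, `X` is diffeomorphic either to `#^{k′}(S¹ × S³)` or to the
connected sum of `#^{k′} S¹ × S³` with one of `ℂP²` or `ℂP²‾` […]"), which the tree holds as
the (unproved) named fact `Literature.Topology.FourManifolds.msz_trisection_classification_gk`
(`LargeKTrisectionClassification.lean`; its printed proof is Thm. 5.1 there — Gabai's Property
R, Scharlemann, Gordon–Luecke —, Heegaard–Kirby diagrams with Laudenbach–Poénaru, and
Waldhausen's theorem, none of it in the tree).  This file proves the corollary FROM the
classification, following the argument printed in the fact's docstring line by line, every other
input being PROVED in the tree — exactly as `LoopSurgeryHomotopySphereGKProofs.lean` does for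
the loop-surgery corollary `msz_loopSurgery_homotopySphere_gk`:

`msz_chiZero_circleProdSphereThree_gk_of_classification :
  msz_trisection_classification_gk.{v} → msz_chiZero_circleProdSphereThree_gk.{u}`.

1. *"`χ(X) = 2 + g − Σ kᵢ = 0`"* (Gay–Kirby Remark 2 / MSZ Remark 3.12, the hypothesis
   `k₀ + k₁ + k₂ = g + 2`) — `finRelHomology_and_relEuler_of_isGKTrisection`
   (`LoopSurgeryTrisectionEulerProofs.lean`: inclusion–exclusion of the rational Čech Euler
   characteristic over the three sectors; PROVED), `χ` being the tree's `relEuler ℤ ℤ X ∅`.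
2. *"as `χ(#^{k′}(S¹ × S³)) = 2 − 2k′` and `χ(#^{k′}(S¹ × S³) # ±ℂP²) = 3 − 2k′`, `χ(X) = 0`
   forces `k′ = 1` and no `±ℂP²` summand"* — the classification
   (`msz_trisection_classification_gk.of_exists`) and
   `IsCircleProdSum.finRelHomology_and_relEuler_eq`,
   `IsCircleProdSum.relEuler_eq_of_isConnectedSum_complexProjectivePlane` (`CircleProdSumEuler.lean`,
   Gompf–Stipsicz §1.2; PROVED).
3. *"so `X` is diffeomorphic to `S¹ × S³`"* — `#¹(S¹ × S³) = S⁴ # (S¹ × S³) ≅ S¹ × S³`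
   (`IsCircleProdSum.nonempty_diffeomorph_sphereOne_prod_sphereThree_of_one`, Kervaire–Milnor
   Lemma 2.1; PROVED), onto Mathlib's product manifold `𝕊¹ × 𝕊³` (model `(𝓡 1).prod (𝓡 3)`).

Universes: steps 1–3 are carried out for `X : Type` (the Euler-characteristic lemmas of
`CircleProdSumEuler.lean` live there); a trisected `X : Type u` is moved with its trisection and
orientation to its small copy `Shrink.{0} X` (`small_of_secondCountableTopology`,
`ManifoldShrink.diffeomorph`, `ManifoldShrink.orientation`, `IsGKTrisection.preimage_diffeomorph`),
and the diffeomorphism `Shrink.{0} X ≅ 𝕊¹ × 𝕊³` is composed with `X ≅ Shrink.{0} X`; the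
classification may be supplied at any universe (`msz_trisection_classification_gk_of_univ`).  Also
recorded: `msz_chiZero_circleProdSphereThree_gk_of_univ` (the fact at one universe gives it at
every universe).

Everything here is proved; no definitions, no named facts.  The discharge
`msz_chiZero_circleProdSphereThree_gk_holds` is then `… _of_classification h` for a proof `h` of
the classification fact, once the tree has one; nothing weaker than Thm. 1.2 in print gives the
corollary (the `χ = 0` slice still needs Waldhausen's theorem, Laudenbach–Poénaru and the
genus-one classification).

## References

* J. Meier, T. Schirmer, A. Zupan, *Classification of trisections and the Generalized Property R
  Conjecture*, Proc. AMS 144 (2016) 4983–4997, arXiv:1507.06561: Def. 1.1, Thm. 1.2 (p. 2;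
  proof §5 via Thm. 5.1), Remark 3.12, Remark 5.2. [MeierSchirmerZupan2016]
* M. Tange, zbMATH review Zbl 1381.57018 (`k′ = min{k₂, k₃}`). [Tange2018ZblMSZ]
* D. Gay, R. Kirby, *Trisecting 4-manifolds*, Geom. Topol. 20 (2016), Remark 2. [GayKirby2016]
* R. E. Gompf, A. I. Stipsicz, *4-Manifolds and Kirby Calculus* (1999), §1.2. [GompfStipsicz1999]
* M. Kervaire, J. Milnor, *Groups of homotopy spheres I*, Ann. of Math. 77 (1963), §2,
  Lemma 2.1. [KervaireMilnor1963]
-/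

noncomputable section

open scoped Manifold ContDiff Topology
open Set Function
open Literature.AlgebraicTopology.SingularHomology

namespace Literature.Topology.FourManifolds

universe u v

/-- **Steps 1–3, in `Type`: GIVEN MSZ Thm. 1.2, a GK-trisected closed connected oriented `X`
in the MSZ range with `k₀ + k₁ + k₂ = g + 2` is a copy of `S¹ × S³`.**  `χ(X) = 2 + g − Σ kᵢ = 0`
(`finRelHomology_and_relEuler_of_isGKTrisection`); with `k′` from the classification
(`msz_trisection_classification_gk.of_exists`), `χ = 0` rules out the `# ℂP²` branch
(`χ = 3 − 2k′` is odd) and forces `k′ = 1` in the other (`χ = 2 − 2k′`); and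
`#¹(S¹ × S³) = S⁴ # (S¹ × S³) ≅ S¹ × S³`
(`IsCircleProdSum.nonempty_diffeomorph_sphereOne_prod_sphereThree_of_one`).
[cite: MeierSchirmerZupan2016, Thm. 1.2 (arXiv numbering) and Remark 3.12] -/
theorem nonempty_diffeomorph_sphereOne_prod_sphereThree_of_classification_of_sum_eq
    (h : msz_trisection_classification_gk.{0})
    {X : Type} [TopologicalSpace X] [T2Space X] [SecondCountableTopology X]
    [ChartedSpace (EuclideanSpace ℝ (Fin 4)) X] [IsManifold (𝓡 4) ∞ X] [CompactSpace X]
    [ConnectedSpace X] (o : SmoothOrientation (𝓡 4) X) {g : ℕ} {k : Fin 3 → ℕ}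
    {S : Fin 3 → Set X} (hT : IsGKTrisection X g k S) (hk : ∃ i, g ≤ k i + 1)
    (hsum : k 0 + k 1 + k 2 = g + 2) :
    Nonempty (X ≃ₘ⟮𝓡 4, (𝓡 1).prod (𝓡 3)⟯
      ((Metric.sphere (0 : EuclideanSpace ℝ (Fin 2)) 1) ×
        (Metric.sphere (0 : EuclideanSpace ℝ (Fin 4)) 1))) := by
  -- Step 1: `χ(X) = 2 + g - Σ kᵢ = 0`
  obtain ⟨-, hχ⟩ := finRelHomology_and_relEuler_of_isGKTrisection hT
  have hχ0 : relEuler ℤ ℤ X ∅ = 0 := by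
    rw [hχ, hsum]
    push_cast
    ring
  -- Step 2: the classification, pinned to `#¹(S¹ × S³)` by `χ(X) = 0`
  obtain ⟨k', hk'⟩ := h.of_exists o hT hk
  have hone : IsCircleProdSum 1 X := by
    rcases hk' with hk' | ⟨M, _, _, _, _, _, _, _, hM, hcs⟩
    · obtain ⟨-, hχ'⟩ := hk'.finRelHomology_and_relEuler_eq
      have h1 : k' = 1 := by omega
      subst h1
      exact hk'
    · obtain ⟨-, hχ'⟩ := hM.relEuler_eq_of_isConnectedSum_complexProjectivePlane hcs
      exfalso
      omega
  -- Step 3: `#¹(S¹ × S³) ≅ S¹ × S³`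
  exact hone.nonempty_diffeomorph_sphereOne_prod_sphereThree_of_one

/-- **`msz_chiZero_circleProdSphereThree_gk` from Meier–Schirmer–Zupan's classification theorem**
(Thm. 1.2; tree fact `msz_trisection_classification_gk`, at any universe `v`), at every universe
`u`.  The classification descends to `Type` (`msz_trisection_classification_gk_of_univ`); the
trisected `X : Type u` is moved to its small copy `Shrink.{0} X` (`small_of_secondCountableTopology`,
`ManifoldShrink.diffeomorph`) together with its orientation (`ManifoldShrink.orientation`) and its
trisection, of the same type `(g; k)` (`IsGKTrisection.preimage_diffeomorph`); there steps 1–3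
apply (`nonempty_diffeomorph_sphereOne_prod_sphereThree_of_classification_of_sum_eq`), and
`X ≅ Shrink.{0} X ≅ 𝕊¹ × 𝕊³`.  So a discharge of the classification (at any one universe)
discharges this fact everywhere: `msz_chiZero_circleProdSphereThree_gk_holds := … _of_classification h`.
[cite: MeierSchirmerZupan2016, Thm. 1.2 (arXiv numbering) and Remark 3.12] -/
theorem msz_chiZero_circleProdSphereThree_gk_of_classification
    (h : msz_trisection_classification_gk.{v}) : msz_chiZero_circleProdSphereThree_gk.{u} := by
  have h0 : msz_trisection_classification_gk.{0} := msz_trisection_classification_gk_of_univ h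
  intro X _ _ _ _ _ _ _ o g k S hT hk hsum
  haveI : Small.{0} X := small_of_secondCountableTopology X
  let ψ : Shrink.{0} X ≃ₘ⟮𝓡 4, 𝓡 4⟯ X := ManifoldShrink.diffeomorph (𝓡 4) X ∞
  have hT' : IsGKTrisection (Shrink.{0} X) g k (fun i => ψ ⁻¹' S i) := hT.preimage_diffeomorph ψ
  obtain ⟨Φ⟩ := nonempty_diffeomorph_sphereOne_prod_sphereThree_of_classification_of_sum_eq h0
    (ManifoldShrink.orientation o) hT' hk hsum
  exact ⟨ψ.symm.trans Φ⟩

/-- **`msz_chiZero_circleProdSphereThree_gk` at one universe gives it at every universe**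
(universe bookkeeping, as `msz_trisection_classification_gk_univ_iff`): move `X : Type u` with
its orientation and trisection to `Shrink.{v} X`, apply the fact there, and compose the resulting
diffeomorphism onto `𝕊¹ × 𝕊³` with `X ≅ Shrink.{v} X`. [cite: MeierSchirmerZupan2016, Thm. 1.2 (arXiv numbering)] -/
theorem msz_chiZero_circleProdSphereThree_gk_of_univ
    (h : msz_chiZero_circleProdSphereThree_gk.{v}) : msz_chiZero_circleProdSphereThree_gk.{u} := by
  intro X _ _ _ _ _ _ _ o g k S hT hk hsum
  haveI : Small.{v} X := small_of_secondCountableTopology X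
  let ψ : Shrink.{v} X ≃ₘ⟮𝓡 4, 𝓡 4⟯ X := ManifoldShrink.diffeomorph (𝓡 4) X ∞
  have hT' : IsGKTrisection (Shrink.{v} X) g k (fun i => ψ ⁻¹' S i) := hT.preimage_diffeomorph ψ
  obtain ⟨Φ⟩ := h (Shrink.{v} X) (ManifoldShrink.orientation o) g k _ hT' hk hsum
  exact ⟨ψ.symm.trans Φ⟩

/-- `msz_chiZero_circleProdSphereThree_gk` does not depend on the universe.
[cite: MeierSchirmerZupan2016, Thm. 1.2 (arXiv numbering)] -/
theorem msz_chiZero_circleProdSphereThree_gk_univ_iff :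
    msz_chiZero_circleProdSphereThree_gk.{u} ↔ msz_chiZero_circleProdSphereThree_gk.{v} :=
  ⟨msz_chiZero_circleProdSphereThree_gk_of_univ, msz_chiZero_circleProdSphereThree_gk_of_univ⟩

end Literature.Topology.FourManifolds

end
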